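import Summits.ResolutionOfSingularities.ResolutionOfSingularities.Theorems.ValuativeLuAlphaPTorsorContentOrigin
import Summits.ResolutionOfSingularities.ResolutionOfSingularities.Theorems.ValuativeLuAlphaPTorsorColengthDrop

/-!
# Giraud's corner step: the colength of the finite part of the log-content drops

Helper file for the stub `giraud_corner_step` (V8, Giraud 1983 Lemme 2.3(i) in tree language) of
the line `pfaff-line-log-final-forms` (crux `Valuative.LuAlphaPTorsor`, item
`stmt-ResolutionOfSingularities-0641`).

Setting: `R ⊆ K` a two-dimensional regular local ring dominated by the valuation ring `O`, `R₁`
its quadratic transform along `O`, `u = (u 0, u 1)` a regular system of parameters of `R` with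
dual `ℤ`-derivations `D`, and `x := u i₀` of MINIMAL value in `𝔪` (hence `x ≠ 0` and
`R₁ = (R[y/x])_{𝔪_O ∩ R[y/x]}`, `y` the other parameter, by the uniqueness of the quadratic
transform along `O`). At a CORNER (full boundary) the log-content ideal
`C(f) = Ideal.span {δ f | δ logarithmic}` factors as `(g) · J₀` with `J₀` of finite colength,
`J₀ ≠ R`; let `r = ord J₀ ≥ 1`.

* `giraud_corner_step` — in the origin chart `u' i₀ = x`, `u' j = u_j / x` of `R₁` (full
  boundary again) the log-content of `f` is the TOTAL transform `C(f) R₁`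
  (`content_quadraticTransform_origin`), and `J₀ R₁ = xʳ · J₀'` with `J₀'` the localised weak
  transform (`map_eq_span_pow_mul_weakTransform`), so `C(f; R₁) = (g xʳ) · J₀'` with
  `λ(R₁/J₀') < λ(R/J₀)` (`length_quotient_weakTransform_map_lt_of_not_le`, Giraud 2.1.1).

References: J. Giraud, *Forme normale d'une fonction sur une surface de caractéristique
positive*, Bull. SMF 111 (1983), Lemme 2.3(i); C. Huneke, I. Swanson, *Integral Closure of
Ideals, Rings, and Modules* (2006), Lemma 14.3.4.
-/

set_option linter.dupNamespace false

noncomputable section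

open IsLocalRing Literature.AlgebraicGeometry.Resolution

namespace Summit.ResolutionOfSingularities.ResolutionOfSingularities.Theorems.PfaffLine

section CornerStep

/-- `Fin 2 = {a, a + 1}` for every `a : Fin 2`. [folklore] -/
theorem fin_two_eq_or_eq_add_one_cornerStep : ∀ a b : Fin 2, b = a ∨ b = a + 1 := by decide

/-- An ideal of finite colength in a ring of Krull dimension `2` is non-zero (`R/0 = R` of finite
length would make `R` Artinian, of dimension `0`). [folklore] -/
theorem ne_bot_of_isFiniteLength_quotient_cornerStep {R : Type*} [CommRing R]
    (hdim : ringKrullDim R = 2) {J : Ideal R} (hfin : IsFiniteLength R (R ⧸ J)) : J ≠ ⊥ := by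
  rintro rfl
  obtain ⟨-, hArt⟩ := isFiniteLength_iff_isNoetherian_isArtinian.mp hfin
  haveI : IsArtinianRing R :=
    isArtinian_of_linearEquiv (Submodule.quotEquivOfEqBot (⊥ : Ideal R) rfl)
  have h0 : ringKrullDim R ≤ 0 := Ring.krullDimLE_iff.mp inferInstance
  rw [hdim] at h0
  exact absurd h0 (by norm_num)

/-- **The order of a proper non-zero ideal** of a Noetherian local ring: `J ⊆ 𝔪ʳ`, `J ⊄ 𝔪ʳ⁺¹`
for a unique `r ≥ 1` (Krull's intersection theorem). [folklore] -/
theorem exists_order_cornerStep {R : Type*} [CommRing R] [IsLocalRing R] [IsNoetherianRing R]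
    {J : Ideal R} (hJtop : J ≠ ⊤) (hJbot : J ≠ ⊥) :
    ∃ r : ℕ, 1 ≤ r ∧ J ≤ maximalIdeal R ^ r ∧ ¬ J ≤ maximalIdeal R ^ (r + 1) := by
  classical
  have hJm : J ≤ maximalIdeal R := le_maximalIdeal hJtop
  have hex : ∃ n, ¬ J ≤ maximalIdeal R ^ (n + 1) := by
    by_contra hall
    apply hJbot
    rw [eq_bot_iff, ← Ideal.iInf_pow_eq_bot_of_isLocalRing (maximalIdeal R)
      (maximalIdeal.isMaximal R).ne_top]
    exact le_iInf fun n => (not_not.mp (not_exists.mp hall n)).trans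
      (Ideal.pow_le_pow_right (Nat.le_succ n))
  refine ⟨Nat.find hex, ?_, ?_, Nat.find_spec hex⟩
  · rw [Nat.one_le_iff_ne_zero]
    intro h0
    have h1 : ¬ J ≤ maximalIdeal R ^ (0 + 1) := h0 ▸ Nat.find_spec hex
    rw [zero_add, pow_one] at h1
    exact h1 hJm
  · rcases Nat.eq_zero_or_eq_succ_pred (Nat.find hex) with h0 | hsucc
    · rw [h0, pow_zero, Ideal.one_eq_top]; exact le_top
    · have hmin := Nat.find_min hex (show Nat.find hex - 1 < Nat.find hex by omega)
      rw [not_not] at hmin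
      rw [hsucc]
      exact hmin

variable {K : Type} [Field K]

/-- For `x ∈ R ⊆ O` of minimal value in `𝔪_R ≠ 0`: `x ≠ 0`. [folklore] -/
theorem ne_zero_of_minimal_value_cornerStep {R : Subring K} [IsRegularLocalRing R]
    (O : ValuationSubring K) (hdim : ringKrullDim R = 2) {x : R}
    (hmin : ∀ z ∈ maximalIdeal R, O.valuation (z : K) ≤ O.valuation ((x : R) : K)) : x ≠ 0 := by
  intro hx
  apply maximalIdeal_ne_span_singleton hdim (0 : R)
  rw [Ideal.span_singleton_zero, eq_bot_iff]
  intro z hz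
  have h1 := hmin z hz
  rw [hx, ZeroMemClass.coe_zero, map_zero, le_zero_iff, map_eq_zero] at h1
  exact (Submodule.mem_bot R).mpr (ZeroMemClass.coe_eq_zero.mp h1)

/-- **The quadratic transform along `O` is the local ring at the centre of the chart of ANY
generator of minimal value**: if `u : Fin d → R` generates `𝔪_R` and `x = u i₀ ≠ 0` has minimal
value, then `R₁ = (R[𝔪/x])_{𝔪_O ∩ R[𝔪/x]}` (uniqueness of the quadratic transform along `O`,
`IsQuadraticTransformAlong.unique`). [folklore] -/
theorem eq_locAtCentre_blowupRing_cornerStep (O : ValuationSubring K) (R R₁ : Subring K)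
    [IsLocalRing R] (h : IsQuadraticTransformAlong O R R₁) (hRO : R ≤ O.toSubring) {d : ℕ}
    (u : Fin d → R) (hspan : Ideal.span (Set.range u) = maximalIdeal R) (i₀ : Fin d)
    (hx0 : u i₀ ≠ 0)
    (hmin : ∀ z ∈ maximalIdeal R, O.valuation (z : K) ≤ O.valuation ((u i₀ : R) : K)) :
    R₁ = locAtCentre (blowupRing R ((u i₀ : R) : K)) O := by
  classical
  have hum : ∀ j, u j ∈ maximalIdeal R := fun j =>
    hspan ▸ Ideal.subset_span (Set.mem_range_self j)
  refine h.unique ⟨inferInstance, hRO, Finset.univ.image u, u i₀, ?_,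
    Finset.mem_image_of_mem u (Finset.mem_univ i₀), hx0, ?_, ?_⟩
  · rw [Finset.coe_image, Finset.coe_univ, Set.image_univ]; exact hspan
  · intro z hz
    obtain ⟨j, -, rfl⟩ := Finset.mem_image.mp hz
    exact hmin (u j) (hum j)
  · rw [Finset.coe_image, Finset.coe_univ, Set.image_univ,
      blowupRing_eq_closure_of_span_eq ((u i₀ : R) : K) (Set.range u) hspan]

end CornerStep

/-- **Registered stub `giraud_corner_step`** (V8: Giraud 1983, Lemme 2.3(i) in tree language).
At a CORNER (full boundary `u = (u 0, u 1)` a regular system of parameters) of the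
two-dimensional regular local ring `R ⊆ K` dominated by `O`, with `x = u i₀` of minimal value and
log-content `C(f) = (g) · J₀` (`J₀` of finite colength, `J₀ ≠ R`): in the origin chart
`u' i₀ = x`, `u' j = u_j / x` of the quadratic transform `R₁` along `O` the log-content of `f` is
`(g') · J₀'` with `λ_{R₁}(R₁/J₀') < λ_R(R/J₀)`. Proof: `R₁ = (R[y/x])_{𝔪_O ∩ R[y/x]}`
(`eq_locAtCentre_blowupRing_cornerStep`, `locAtCentre_eq_ofPrime`); the log-content is the total
transform `C(f) R₁ = (g) · J₀ R₁` (`content_quadraticTransform_origin`); `J₀ R₁ = (xʳ) · J₀'`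
for the localised weak transform `J₀'`, `r = ord J₀ ≥ 1` (`map_eq_span_pow_mul_weakTransform`);
and `λ(R₁/J₀') < λ(R/J₀)` (`length_quotient_weakTransform_map_lt_of_not_le`). [folklore] -/
theorem giraud_corner_step : ∀ {K : Type} [Field K] (O : ValuationSubring K) (R R₁ : Subring K) [IsRegularLocalRing R] [IsLocalRing R₁] (h : Literature.AlgebraicGeometry.Resolution.IsQuadraticTransformAlong O R R₁), ringKrullDim R = 2 → Literature.AlgebraicGeometry.Resolution.SubringDominates R O.toSubring → (∀ (N : Type) [CommRing N] (ψ : R →+* N) (δ₀ : R →+ N), (∀ a b, δ₀ (a * b) = ψ a * δ₀ b + ψ b * δ₀ a) → ∀ Y : Finset R, ∃ (m : ℕ) (Δ : Fin m → Derivation ℤ R R) (nn : Fin m → N), ∀ y ∈ Y, δ₀ y = Finset.univ.sum fun j => ψ (Δ j y) * nn j) → ∀ (u : Fin 2 → R) (D : Fin 2 → Derivation ℤ R R), (∀ i j, D i (u j) = if i = j then 1 else 0) → Ideal.span (Set.range u) = maximalIdeal R → ∀ (i₀ : Fin 2), (∀ z ∈ maximalIdeal R, O.valuation (z : K) ≤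 O.valuation ((u i₀ : R) : K)) → ∀ (f g : R) (J₀ : Ideal R), Ideal.span {b | ∃ δ : Derivation ℤ R R, (∀ i ∈ (Finset.univ : Finset (Fin 2)), δ (u i) ∈ Ideal.span {u i}) ∧ δ f = b} = Ideal.span {g} * J₀ → IsFiniteLength R (R ⧸ J₀) → J₀ ≠ ⊤ → ∃ (u' : Fin 2 → R₁) (g' : R₁) (J₀' : Ideal R₁), ((u' i₀ : R₁) : K) = ((u i₀ : R) : K) ∧ (∀ j, j ≠ i₀ → ((u' j : R₁) : K) = ((u j : R) : K) / ((u i₀ : R) : K)) ∧ Ideal.span {b | ∃ δ' : Derivation ℤ R₁ R₁, (∀ j ∈ (Finset.univ : Finset (Fin 2)), δ' (u' j) ∈ Ideal.span {u' j}) ∧ δ' (Subring.inclusion h.le f) = b} = Ideal.span {g'} * J₀' ∧ IsFiniteLength R₁ (R₁ ⧸ J₀') ∧ Module.length R₁ (R₁ ⧸ J₀') < Module.length R (R ⧸ J₀) := by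
  intro K _ O R R₁ _ _ h hdim hdom hrich u D hD hspan i₀ hmin f g J₀ hJ hfin hJtop
  classical
  -- the two parameters `x = u i₀`, `y = u (i₀ + 1)`
  have hum : ∀ j, u j ∈ maximalIdeal R := fun j =>
    hspan ▸ Ideal.subset_span (Set.mem_range_self j)
  have hRO : R ≤ O.toSubring := hdom.1
  have hx0 : u i₀ ≠ 0 := ne_zero_of_minimal_value_cornerStep O hdim hmin
  have hx0K : ((u i₀ : R) : K) ≠ 0 := fun e => hx0 (Subtype.ext e)
  have hrange : Set.range u = {u i₀, u (i₀ + 1)} := by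
    ext z
    simp only [Set.mem_range, Set.mem_insert_iff, Set.mem_singleton_iff]
    constructor
    · rintro ⟨j, rfl⟩
      rcases fin_two_eq_or_eq_add_one_cornerStep i₀ j with rfl | rfl
      · exact Or.inl rfl
      · exact Or.inr rfl
    · rintro (rfl | rfl)
      exacts [⟨i₀, rfl⟩, ⟨i₀ + 1, rfl⟩]
  have hm : maximalIdeal R = Ideal.span {u i₀, u (i₀ + 1)} := by rw [← hspan, hrange]
  -- the chart `A = R[y/x] ⊆ O` and `R₁ = A_{𝔪_O ∩ A}`
  have hyxO : ((u (i₀ + 1) : R) : K) / ((u i₀ : R) : K) ∈ O.toSubring := by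
    change ((u (i₀ + 1) : R) : K) / ((u i₀ : R) : K) ∈ O
    rw [← O.valuation_le_one_iff, map_div₀,
      div_le_one₀ (pos_iff_ne_zero.mpr ((map_ne_zero _).mpr hx0K))]
    exact hmin _ (hum _)
  have hAO : chartAdjoin (K := K) (u i₀) (u (i₀ + 1)) ≤ O.toSubring := adjoin_toSubring_le hRO hyxO
  have hA : blowupRing R ((u i₀ : R) : K) = chartAdjoin (K := K) (u i₀) (u (i₀ + 1)) :=
    blowupRing_eq_adjoin hm
  have hR₁T : R₁ = (LocalSubring.ofPrime (chartAdjoin (K := K) (u i₀) (u (i₀ + 1)))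
      (subringCentre (chartAdjoin (K := K) (u i₀) (u (i₀ + 1))) O hAO)).toSubring := by
    rw [eq_locAtCentre_blowupRing_cornerStep O R R₁ h hRO u hspan i₀ hx0 hmin, hA]
    exact locAtCentre_eq_ofPrime hAO
  subst hR₁T
  set A : Subring K := chartAdjoin (K := K) (u i₀) (u (i₀ + 1)) with hAdef
  set Q : Ideal A := subringCentre A O hAO with hQdef
  set T : Subring K := (LocalSubring.ofPrime A Q).toSubring with hTdef
  have hAT : A ≤ T := LocalSubring.le_ofPrime A Q
  -- the order `r ≥ 1` of `J₀`
  obtain ⟨r, hr1, hJr, hJr1⟩ :=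
    exists_order_cornerStep hJtop (ne_bot_of_isFiniteLength_quotient_cornerStep hdim hfin)
  -- the origin chart coordinates
  have hxT : ((u i₀ : R) : K) ∈ T := h.le (u i₀).2
  have hdivT : ∀ j, ((u j : R) : K) / ((u i₀ : R) : K) ∈ T := fun j =>
    hAT (hA ▸ div_mem_blowupRing ((u i₀ : R) : K) (hum j))
  set u' : Fin 2 → T := fun j =>
    if j = i₀ then ⟨((u i₀ : R) : K), hxT⟩ else ⟨((u j : R) : K) / ((u i₀ : R) : K), hdivT j⟩
    with hu'
  have hi₀' : ((u' i₀ : T) : K) = ((u i₀ : R) : K) := by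
    simp [hu']
  have hj' : ∀ j, j ≠ i₀ → ((u' j : T) : K) = ((u j : R) : K) / ((u i₀ : R) : K) := by
    intro j hj
    simp [hu', hj]
  -- the content is the total transform
  have hC := content_quadraticTransform_origin O R T h hrich u D hD hspan i₀ hx0K u' hi₀' hj' f
  have hcomp : Subring.inclusion h.le = (algebraMap A T).comp (chartIncl (K := K) (u i₀) (u (i₀ + 1))) :=
    RingHom.ext fun _ => Subtype.ext rfl
  have hJ₀map : J₀.map (Subring.inclusion h.le) =
      Ideal.span {algebraMap A T (chartIncl (u i₀) (u (i₀ + 1)) (u i₀)) ^ r} *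
        (weakTransformChart (u i₀) (u (i₀ + 1)) J₀ r).map (algebraMap A T) := by
    rw [hcomp, ← Ideal.map_map, map_eq_span_pow_mul_weakTransform hm hx0 hJr, Ideal.map_mul,
      Ideal.map_span, Set.image_singleton, map_pow]
  -- the colength drops
  have hlt := length_quotient_weakTransform_map_lt_of_not_le (K := K) hdim hm hx0 hr1 hJr hJr1
    hfin Q
  refine ⟨u', Subring.inclusion h.le g * algebraMap A T (chartIncl (u i₀) (u (i₀ + 1)) (u i₀)) ^ r,
    (weakTransformChart (u i₀) (u (i₀ + 1)) J₀ r).map (algebraMap A T), hi₀', hj', ?_,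
    Module.length_ne_top_iff.mp (ne_top_of_lt hlt), hlt⟩
  rw [hC, hJ, Ideal.map_mul, hJ₀map, Ideal.map_span, Set.image_singleton, ← mul_assoc,
    Ideal.span_singleton_mul_span_singleton]

end Summit.ResolutionOfSingularities.ResolutionOfSingularities.Theorems.PfaffLine

end
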